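import Summits.BirchSwinnertonDyer.Rank1Residual.ManinAdditive.KummerDiamondShapeLaws
import Literature.NumberTheory.EllipticCurves.ModularSymbolsEichlerShimuraHoldsProofs
import HarnessLib
import HarnessLib.Audit.Tags

/-!
# desc g26 — THE SHIMURA KERNEL IS CYCLIC (MEMO-desc §51), v2

An independent (E-side, Shimura-subgroup) derivation of the es g38 EXCLUSION THEOREM (MEMO-es §59, rows E-es-185/186 =
`KummerDiamondShapeLaws`, audited ref1 §R215) reaches a STRICTLY STRONGER statement, typed here as two candidate rows:

* **E-desc-g26-1 `Gamma1PeriodsNotInsideTwiceGamma0Periods`** — for every elliptic newform `f`: `Λ₁(f) ⊄ 2Λ₀(f)`, i.e. the `2`-part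
  of `K = Λ₀(f)/Λ₁(f)` (≅ the Shimura kernel `E₀ ∩ Σ(N)`) is CYCLIC.  (E-es-185 ∧ 186 give `Λ₁ ≠ 2Λ₀`, the case `K ≅ (ℤ/2)²` exactly;
  the desc argument works with `E₀[2] ⊆ Σ(N)` alone, per `2`-torsion point `T = s_χ`, through the E-free cusp-class law
  `x(φ₀(1/d)) − x(T) ≡ d(χ^{(N/d)})` for unitary `d ∥ N` — validated 19/19 + 8/1020 control, N ≤ 2000.)  No hypothesis on `N`, no
  lattice-optimality, no CDT, no rank, no Atkin–Lehner sign is used.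
* **E-desc-g26-2 `ShimuraKernelCyclic`** — `Λ₀(f) = ℤ z₀ + Λ₁(f)` for some period `z₀`: `K` is cyclic (odd part: `E₀[ℓ] ⊆ Σ(N)` would make
  `E₀[ℓ]` of `μ`-type, `det = χ_cyc² ≠ χ_cyc` for odd `ℓ`; `2`-part: row 1).  es E15: `K` cyclic 1025/1025, E38 33/33 + 17/17 (observed;
  here claimed as a paper theorem).

PROVED glue (kernel-checked): row 1 ⟹ E-an-152b `ShimuraIndexNeFourAtFour` ⟹ (landed `CDivAssembly.maninOddAtFour_of_CDT_indexNeFour`)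
C2 `ManinOddAtFour` under CDT; row 1 ⟹ E-an-152c (these two cone-side compositions live in the sibling `ShimuraKernelCyclicSplit.lean`); and `legendreEight r t = freyTwistCurve (2t) r` (the desc family `y² = x(x − r²)(x − 8t²)`
IS the es Frey-twist family).  NOTHING HERE PROVES C2, MANIN's CONJECTURE OR BSD; rows 1–2 are `@[conjecture] def`s (paper theorems of
MEMO-desc §51 pending referee audit).  [cite: LingOesterle1991, Thm. 2 and Thm. 6] [cite: Stevens1989, §2] [cite: Mazur1977, §II.11]

TYPER NOTE (typer g21, T-desc-g26).  SOURCE = HOME/desc/g26/lean/Sketch-desc-g26.lean v2 sha16 0b228e6b9af6014f (130 l.; desc: farm rc 0·0·0·0;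
BC7 Probe-desc-g26.lean adbceb6dbc5902ef row 2 CLEAN, row 1 implies-152b by design; MEMO-desc §51 2641b0e60085ada0, pack HOME/desc/g26/ +
SHA16SUMS.desc.g26) VERBATIM, SPLIT BY IMPORT CONE (HOME/typer/README gotcha 96/118): two of the sketch's imports
(`Theorems.ManinLocalTwoThreeCDivisionAssembly`, `Theorems.ManinLocalTwoThreeCDivisionNeronPeriodsConsumers`) are inside the
`Theses.ManinLocalTwoThree` cone, so THIS LEAF keeps both rows, the cone-free glue (`periodLatticeGamma1_ne_two_mul_of_notInsideTwice`,
`shimuraIndexNeFourAtFour_of_notInsideTwice`, `periodLatticeGamma1_ne_two_mul_of_es`) and §3 (`legendreEight` = es's `freyTwistCurve`) on the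
route-independent import `…ManinAdditive.KummerDiamondShapeLaws` (p757011; closure Theses-free), while the two route-cone theorems —
`shimuraIndexNeFourAtFourOddSquarefree_of_notInsideTwice` (⊢ E-an-152c `CDivisionNeron.ShimuraIndexNeFourAtFourOddSquarefree`, p755600) and
`maninOddAtFour_of_CDT_notInsideTwice : CDT → row 1 → Theses.ManinLocalTwoThree.ManinOddAtFour` (via `CDivAssembly.maninOddAtFour_of_CDT_indexNeFour`,
p754408) — are PROVED verbatim in the sibling `ShimuraKernelCyclicSplit.lean`.  Other typer deltas: namespace `…ManinAdditive.DescG26` →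
`…ManinAdditive.ShimuraCyclic` (named for the mathematics; the file keeps desc's requested name `ShimuraKernelCyclic.lean`); the leaf drops the
now-unused `open …Theorems.ManinLocalTwoThree`; cite keys unchanged (`LingOesterle1991`, `Stevens1989`, `Mazur1977`, `CalegariDimitrovTang2025`, all in
references.bib).  ROWS (desc's `@[conjecture]` tags; nothing asserted): **E-desc-g26-1 `Gamma1PeriodsNotInsideTwiceGamma0Periods`**, **E-desc-g26-2
`ShimuraKernelCyclic`**.  REFUTER: ref1/ref2 R-desc-g26 PENDING at landing.  No instances, no notation, no sorry.  bears_on: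
stmt-BirchSwinnertonDyer-22967 (C2 «⟸ CDT ∧ row 1», priced per the director's 00:56Z freeze).  BSD is not proved by this; Manin c = 1 not proved;
C2/C3 OPEN.
APPEND (typer g21, T-desc-g26 v3 626a367b88d23d06, 191 l., rc 0·0·0·0): §4 VERBATIM — the KERNEL-CHECKED edge **`notInsideTwice_of_shimuraKernelCyclic :
ShimuraKernelCyclic → Gamma1PeriodsNotInsideTwiceGamma0Periods`** (rank-2 parity on a ℤ-basis of `Λ₀(f)`, via the PROVED tree theorem
`isZLattice_periodLattice_holds`; + import Literature `ModularSymbolsEichlerShimuraHoldsProofs`) and `shimuraIndexNeFourAtFour_of_shimuraKernelCyclic` (row 2 ⊢ E-an-152b);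
v3's two cone-side consumers (`shimuraIndexNeFourAtFourOddSquarefree_of_shimuraKernelCyclic`, `maninOddAtFour_of_CDT_shimuraKernelCyclic`) are appended to the sibling.
[cite: Shimura1971, Thm. 7.14]
APPEND 2 (typer g21, T-desc-g26 v4 4c550eb56d9271be, 246 l., rc 0·0·0·0; BC7 v4 probe cd20871653e402c6 CLEAN): the `f`-ONLY rows **E-desc-g26-1♮
`NewformGamma1PeriodsNotInsideTwice`** / **E-desc-g26-2♮ `NewformShimuraKernelCyclic`** over `(f : CuspForm (Gamma0 N) 2) (hf : IsNewform0 f) (hQ : coeffField f = ⊥)`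
(A-ref1-215-1's «ONE Lean row for ℤ-newforms», in the stronger «⊄ 2Λ₀» form), the PROVED core parity lemma `not_cyclic_and_insideTwice` and the edges
`newformNotInsideTwice_of_newformCyclic`, `notInsideTwice_of_newform`, `shimuraKernelCyclic_of_newform`, `newform_periodLatticeGamma1_ne_two_mul` — VERBATIM;
v4's re-proof of the landed `notInsideTwice_of_shimuraKernelCyclic` THROUGH the core lemma is NOT applied (the landed proof p758145 is kept as is; the
core lemma is added alongside — same mathematics); v4's cone consumer `maninOddAtFour_of_CDT_newformCyclic` goes to the sibling.
-/

noncomputable section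

open scoped MatrixGroups ModularForm Manifold
open CongruenceSubgroup Complex ModularGroup
open WeierstrassCurve Literature.NumberTheory.EllipticCurves Literature.NumberTheory.EllipticCurves.ModularForms
open Literature.NumberTheory.Automorphic
open Summit.BirchSwinnertonDyer.Rank1Residual.ManinAdditive.ShimuraKernel
open Summit.BirchSwinnertonDyer.Rank1Residual.ManinAdditive.KummerDiamond

namespace Summit.BirchSwinnertonDyer.Rank1Residual.ManinAdditive.ShimuraCyclic

/-! ## §1 The two rows -/

/-- **Row E-desc-g26-1 `Gamma1PeriodsNotInsideTwiceGamma0Periods`** (candidate LAW / paper theorem of MEMO-desc §51; nothing asserted).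
For every modular parametrisation datum (so `f = D.f` is the rational newform of an elliptic curve over `ℚ`): `Λ₁(f) ⊄ 2Λ₀(f)` —
some `Γ₁(N)`-period of `f` is not twice a `Γ₀(N)`-period.  Equivalently the `2`-part of `Λ₀(f)/Λ₁(f) ≅ E₀ ∩ Σ(N)` is cyclic, i.e.
`E₀[2] ⊄ Σ(N)` for the optimal curve `E₀ = ℂ/Λ₀(f)`.  Paper proof (MEMO-desc §51): `E₀[2] ⊆ Σ(N) = Hom(G_N, 𝔾_m)`,
`G_N = ((ℤ/M)ˣ)/±1`, `M = ∏ p^{⌈v_p(N)/2⌉}` (cusp inertia = LEMMA M of es §59); the `2`-isogeny descent classes of the unitary cusp images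
`κ(φ₀(1/(N/Q))) = (d(χ_{T₁}^{(Q)}), d(χ_{T₂}^{(Q)}))` (E-free cusp-class law, from Stevens 1982 Thm. 1.3.1(b)); the sign lemma
(`x − e₁ > 0` on `E₀(ℚ)`, `x − e₂ < 0` exactly off the identity component) leaves support `{2, q}`, `χ_{T₁}^{(2)} = χ₈`, hence `2⁵ ∣ N`
and `E₀ ≅ y² = x(x − r²)(x − 8t²)`, whose conductor exponent at `2` is `4` (Tate) — contradiction.
Why it might fail: a normalisation slip in the cusp-class law at composite odd part (validated only at `ω(m) ≤ 1` levels + 15a1 by hand).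
[cite: LingOesterle1991, Thm. 2] [cite: Stevens1989, §2] -/
@[conjecture] def Gamma1PeriodsNotInsideTwiceGamma0Periods : Prop :=
  ∀ (W₀ : WeierstrassCurve ℚ) [W₀.IsElliptic] {N : ℕ} [NeZero N] (D₀ : ModularParametrizationData W₀ N),
    ¬ (∀ z ∈ periodLatticeGamma1 D₀.f, ∃ w ∈ periodLattice D₀.f, z = 2 * w)

/-- **Row E-desc-g26-2 `ShimuraKernelCyclic`** (candidate LAW / paper theorem of MEMO-desc §51; nothing asserted).  For every modular
parametrisation datum, `Λ₀(f)/Λ₁(f)` is CYCLIC: `Λ₀(f) = ℤ·z₀ + Λ₁(f)` for some `z₀ ∈ Λ₀(f)`.  Paper proof: `Λ₀/Λ₁ ≅ E₀ ∩ Σ(N)` (Pontryagin);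
a non-cyclic `ℓ`-part means `E₀[ℓ] ⊆ Σ(N)`, so `E₀[ℓ]` is of `μ`-type and `det ρ_{E₀,ℓ} = χ_cyc²`, contradicting `det = χ_cyc` unless `ℓ = 2`;
`ℓ = 2` is row E-desc-g26-1.  Data: es E15 `Λ₀/Λ₁` cyclic 1025/1025 (snf `[n,1]`, `n ∈ {1,2,3,4,5}`), es E38 33/33 + 17/17; desc KUMMER-4N2000:
0/54 optimal curves with full rational `2`-torsion (`4 ∣ N ≤ 2000`) have two `Σ`-`2`-torsion points.
Why it might fail: as row 1 (the odd part is unconditional).  [cite: Mazur1977, §II.11] [cite: LingOesterle1991, Thm. 2] -/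
@[conjecture] def ShimuraKernelCyclic : Prop :=
  ∀ (W₀ : WeierstrassCurve ℚ) [W₀.IsElliptic] {N : ℕ} [NeZero N] (D₀ : ModularParametrizationData W₀ N),
    ∃ z₀ ∈ periodLattice D₀.f, ∀ z ∈ periodLattice D₀.f,
      ∃ (k : ℤ) (w : ℂ), w ∈ periodLatticeGamma1 D₀.f ∧ z = (k : ℂ) * z₀ + w

/-! ## §2 PROVED glue -/

/-- Row 1 ⟹ `Λ₁(f) ≠ 2Λ₀(f)` for every datum (the es g38 exclusion statement `periodLatticeGamma1_ne_two_mul`, without its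
lattice-optimality hypothesis). -/
theorem periodLatticeGamma1_ne_two_mul_of_notInsideTwice (h : Gamma1PeriodsNotInsideTwiceGamma0Periods)
    (W₀ : WeierstrassCurve ℚ) [W₀.IsElliptic] {N : ℕ} [NeZero N] (D₀ : ModularParametrizationData W₀ N) :
    ¬ (∀ z : ℂ, z ∈ periodLatticeGamma1 D₀.f ↔ ∃ w ∈ periodLattice D₀.f, z = 2 * w) :=
  fun hidx => h W₀ D₀ (fun z hz => (hidx z).1 hz)

/-- **Row 1 ⟹ E-an-152b `ShimuraIndexNeFourAtFour`.** -/
theorem shimuraIndexNeFourAtFour_of_notInsideTwice (h : Gamma1PeriodsNotInsideTwiceGamma0Periods) :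
    ShimuraIndexNeFourAtFour := by
  intro W₀ _ _ N _ D₀ _h₀ _h4
  exact periodLatticeGamma1_ne_two_mul_of_notInsideTwice h W₀ D₀

/-- es rows E-es-185 ∧ E-es-186 give the WEAKER conclusion `Λ₁ ≠ 2Λ₀` (recorded for comparison: the es theorem, by name). -/
theorem periodLatticeGamma1_ne_two_mul_of_es (h185 : IndexFourForcesFreyTwistShape) (h186 : FreyTwistShapeTwoAdicLaw)
    (W₀ : WeierstrassCurve ℚ) [W₀.IsElliptic] [W₀.IsGloballyMinimal] {N : ℕ} [NeZero N]
    (D₀ : ModularParametrizationData W₀ N) (h₀ : ∀ z ∈ D₀.L.lattice, ∃ w ∈ periodLattice D₀.f, z = D₀.c * w) :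
    ¬ (∀ z : ℂ, z ∈ periodLatticeGamma1 D₀.f ↔ ∃ w ∈ periodLattice D₀.f, z = 2 * w) :=
  periodLatticeGamma1_ne_two_mul h185 h186 W₀ D₀ h₀

/-! ## §3 The desc family is the es family -/

/-- The **Legendre-`8` family** `y² = x(x − r²)(x − 8t²)` reached by the desc cusp-torsor profile (MEMO-desc §51 (9a)/(9b)). -/
def legendreEight (r t : ℤ) : WeierstrassCurve ℚ :=
  ⟨0, -((r : ℚ) ^ 2 + 8 * (t : ℚ) ^ 2), 0, 8 * (r : ℚ) ^ 2 * (t : ℚ) ^ 2, 0⟩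

/-- `legendreEight r t` is LITERALLY es's `freyTwistCurve (2t) r` (`y² = x(x − 2(2t)²)(x − r²)`): the two independent derivations
(es: diamond character + `θ`-Kummer map; desc: Shimura characters + `2`-isogeny descent of cusp images) land on the same family. -/
theorem legendreEight_eq_freyTwistCurve (r t : ℤ) : legendreEight r t = freyTwistCurve (2 * t) r := by
  simp only [legendreEight, freyTwistCurve]
  ext <;> push_cast <;> ring

/-- Hence the desc shape is a Frey-twist shape in es's sense (for `r` odd): any `W` isomorphic to `legendreEight r t` `HasFreyTwistShape`. -/
theorem hasFreyTwistShape_of_legendreEight (W : WeierstrassCurve ℚ) (r t : ℤ) (C : WeierstrassCurve.VariableChange ℚ)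
    (hr : Odd r) (hW : C • W = legendreEight r t) : HasFreyTwistShape W :=
  ⟨2 * t, r, C, even_two_mul t, hr, by rw [hW, legendreEight_eq_freyTwistCurve]⟩

/-! ## §4 Row 2 implies row 1 (kernel-checked, via the PROVED Eichler–Shimura lattice theorem)

`Λ₀(f)` is a `ℤ`-lattice in `ℂ` (`isZLattice_periodLattice_holds`, Shimura 1971 Thm. 7.14, proved in the tree), hence free of
rank `2`; if `Λ₀ = ℤz₀ + Λ₁` and `Λ₁ ⊆ 2Λ₀` then `Λ₀/2Λ₀ ≅ (ℤ/2)²` would be generated by the class of `z₀` — a parity contradiction on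
the coordinates of a `ℤ`-basis.  So `ShimuraKernelCyclic` is the single E-blind row: it implies row 1 and, through it, E-an-152b/152c
and C2 under CDT. -/

/-- **Row 2 ⟹ row 1**: a cyclic Shimura kernel `Λ₀(f) = ℤz₀ + Λ₁(f)` forces `Λ₁(f) ⊄ 2Λ₀(f)` (rank-two parity argument on a
`ℤ`-basis of the lattice `Λ₀(f)`; Shimura 1971, Thm. 7.14 for the lattice property). [cite: Shimura1971, Thm. 7.14] -/
theorem notInsideTwice_of_shimuraKernelCyclic (h : ShimuraKernelCyclic) : Gamma1PeriodsNotInsideTwiceGamma0Periods := by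
  intro W₀ _ N _ D₀ hin
  obtain ⟨z₀, hz₀, hcyc⟩ := h W₀ D₀
  have hf : IsNewform0 D₀.f := D₀.isNewformOf.1
  have hQ : coeffField D₀.f = ⊥ := IsNewformOf.coeffField_eq_bot D₀.isNewformOf
  obtain ⟨hdisc, hZ⟩ := isZLattice_periodLattice_holds (f := D₀.f) hf hQ
  haveI : DiscreteTopology ↥(AddSubgroup.toIntSubmodule (periodLattice D₀.f)) := hdisc
  haveI : IsZLattice ℝ (AddSubgroup.toIntSubmodule (periodLattice D₀.f)) := hZ
  haveI : Module.Free ℤ ↥(AddSubgroup.toIntSubmodule (periodLattice D₀.f)) :=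
    ZLattice.module_free ℝ (AddSubgroup.toIntSubmodule (periodLattice D₀.f))
  haveI : Module.Finite ℤ ↥(AddSubgroup.toIntSubmodule (periodLattice D₀.f)) :=
    ZLattice.module_finite ℝ (AddSubgroup.toIntSubmodule (periodLattice D₀.f))
  have hrank : Module.finrank ℤ ↥(AddSubgroup.toIntSubmodule (periodLattice D₀.f)) = 2 := by
    rw [ZLattice.rank ℝ (AddSubgroup.toIntSubmodule (periodLattice D₀.f)), Complex.finrank_real_complex]
  -- `z₀` and the decomposition `z = k z₀ + 2 w` inside the lattice
  let z₀' : ↥(AddSubgroup.toIntSubmodule (periodLattice D₀.f)) := ⟨z₀, hz₀⟩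
  have key : ∀ z : ↥(AddSubgroup.toIntSubmodule (periodLattice D₀.f)),
      ∃ (k : ℤ) (w : ↥(AddSubgroup.toIntSubmodule (periodLattice D₀.f))), z = k • z₀' + (2 : ℤ) • w := by
    intro z
    obtain ⟨k, w, hw₁, hz⟩ := hcyc z z.2
    obtain ⟨w', hw', hw⟩ := hin w hw₁
    refine ⟨k, ⟨w', hw'⟩, Subtype.ext ?_⟩
    simp [z₀', zsmul_eq_mul, hz, hw]
  -- a `ℤ`-basis with two distinct indices
  let b := Module.Free.chooseBasis ℤ ↥(AddSubgroup.toIntSubmodule (periodLattice D₀.f))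
  have hcard : Fintype.card (Module.Free.ChooseBasisIndex ℤ ↥(AddSubgroup.toIntSubmodule (periodLattice D₀.f))) = 2 := by
    rw [← Module.finrank_eq_card_chooseBasisIndex, hrank]
  obtain ⟨i, j, hij⟩ := Fintype.exists_pair_of_one_lt_card (α :=
    Module.Free.ChooseBasisIndex ℤ ↥(AddSubgroup.toIntSubmodule (periodLattice D₀.f))) (by omega)
  -- coordinates of `b i` and `b j`
  obtain ⟨ki, wi, hi⟩ := key (b i)
  obtain ⟨kj, wj, hj⟩ := key (b j)
  have ei := congrArg (fun v => b.repr v i) hi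
  have eij := congrArg (fun v => b.repr v j) hi
  have ej := congrArg (fun v => b.repr v j) hj
  simp only [b.repr_self, map_add, map_zsmul, Finsupp.add_apply, Finsupp.smul_apply, smul_eq_mul,
    Finsupp.single_apply, if_true, if_neg hij] at ei eij ej
  -- parity
  have h1 : Odd (ki * b.repr z₀' i) := ⟨-(b.repr wi i), by linarith⟩
  have h2 : Even (ki * b.repr z₀' j) := ⟨-(b.repr wi j), by linarith⟩
  have h3 : Odd (kj * b.repr z₀' j) := ⟨-(b.repr wj j), by linarith⟩
  have hodd : Odd (ki * b.repr z₀' j) := Int.odd_mul.mpr ⟨(Int.odd_mul.mp h1).1, (Int.odd_mul.mp h3).2⟩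
  exact (Int.not_even_iff_odd.mpr hodd) h2

/-- Row 2 ⟹ E-an-152b. -/
theorem shimuraIndexNeFourAtFour_of_shimuraKernelCyclic (h : ShimuraKernelCyclic) : ShimuraIndexNeFourAtFour :=
  shimuraIndexNeFourAtFour_of_notInsideTwice (notInsideTwice_of_shimuraKernelCyclic h)

/-- **Core parity lemma** (newform form): for a rational newform `f ∈ S₂(Γ₀(N))`, `Λ₀(f) = ℤz₀ + Λ₁(f)` and `Λ₁(f) ⊆ 2Λ₀(f)` cannot
both hold (rank-two parity argument on a `ℤ`-basis of the lattice `Λ₀(f)`; Shimura 1971, Thm. 7.14 for the lattice property).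
[cite: Shimura1971, Thm. 7.14] -/
theorem not_cyclic_and_insideTwice {N : ℕ} [NeZero N] (f : CuspForm (Gamma0 N) 2) (hf : IsNewform0 f)
    (hQ : coeffField f = ⊥) {z₀ : ℂ} (hz₀ : z₀ ∈ periodLattice f)
    (hcyc : ∀ z ∈ periodLattice f, ∃ (k : ℤ) (w : ℂ), w ∈ periodLatticeGamma1 f ∧ z = (k : ℂ) * z₀ + w)
    (hin : ∀ z ∈ periodLatticeGamma1 f, ∃ w ∈ periodLattice f, z = 2 * w) : False := by
  obtain ⟨hdisc, hZ⟩ := isZLattice_periodLattice_holds (f := f) hf hQ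
  haveI : DiscreteTopology ↥(AddSubgroup.toIntSubmodule (periodLattice f)) := hdisc
  haveI : IsZLattice ℝ (AddSubgroup.toIntSubmodule (periodLattice f)) := hZ
  haveI : Module.Free ℤ ↥(AddSubgroup.toIntSubmodule (periodLattice f)) :=
    ZLattice.module_free ℝ (AddSubgroup.toIntSubmodule (periodLattice f))
  haveI : Module.Finite ℤ ↥(AddSubgroup.toIntSubmodule (periodLattice f)) :=
    ZLattice.module_finite ℝ (AddSubgroup.toIntSubmodule (periodLattice f))
  have hrank : Module.finrank ℤ ↥(AddSubgroup.toIntSubmodule (periodLattice f)) = 2 := by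
    rw [ZLattice.rank ℝ (AddSubgroup.toIntSubmodule (periodLattice f)), Complex.finrank_real_complex]
  -- `z₀` and the decomposition `z = k z₀ + 2 w` inside the lattice
  let z₀' : ↥(AddSubgroup.toIntSubmodule (periodLattice f)) := ⟨z₀, hz₀⟩
  have key : ∀ z : ↥(AddSubgroup.toIntSubmodule (periodLattice f)),
      ∃ (k : ℤ) (w : ↥(AddSubgroup.toIntSubmodule (periodLattice f))), z = k • z₀' + (2 : ℤ) • w := by
    intro z
    obtain ⟨k, w, hw₁, hz⟩ := hcyc z z.2
    obtain ⟨w', hw', hw⟩ := hin w hw₁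
    refine ⟨k, ⟨w', hw'⟩, Subtype.ext ?_⟩
    simp [z₀', zsmul_eq_mul, hz, hw]
  -- a `ℤ`-basis with two distinct indices
  let b := Module.Free.chooseBasis ℤ ↥(AddSubgroup.toIntSubmodule (periodLattice f))
  have hcard : Fintype.card (Module.Free.ChooseBasisIndex ℤ ↥(AddSubgroup.toIntSubmodule (periodLattice f))) = 2 := by
    rw [← Module.finrank_eq_card_chooseBasisIndex, hrank]
  obtain ⟨i, j, hij⟩ := Fintype.exists_pair_of_one_lt_card (α :=
    Module.Free.ChooseBasisIndex ℤ ↥(AddSubgroup.toIntSubmodule (periodLattice f))) (by omega)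
  -- coordinates of `b i` and `b j`
  obtain ⟨ki, wi, hi⟩ := key (b i)
  obtain ⟨kj, wj, hj⟩ := key (b j)
  have ei := congrArg (fun v => b.repr v i) hi
  have eij := congrArg (fun v => b.repr v j) hi
  have ej := congrArg (fun v => b.repr v j) hj
  simp only [b.repr_self, map_add, map_zsmul, Finsupp.add_apply, Finsupp.smul_apply, smul_eq_mul,
    Finsupp.single_apply, if_true, if_neg hij] at ei eij ej
  -- parity
  have h1 : Odd (ki * b.repr z₀' i) := ⟨-(b.repr wi i), by linarith⟩
  have h2 : Even (ki * b.repr z₀' j) := ⟨-(b.repr wi j), by linarith⟩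
  have h3 : Odd (kj * b.repr z₀' j) := ⟨-(b.repr wj j), by linarith⟩
  have hodd : Odd (ki * b.repr z₀' j) := Int.odd_mul.mpr ⟨(Int.odd_mul.mp h1).1, (Int.odd_mul.mp h3).2⟩
  exact (Int.not_even_iff_odd.mpr hodd) h2

/-! ## §5 The `f`-only forms (no Weierstrass carrier; answers A-ref1-215-1 «ONE Lean row `¬(Λ₁(f) = 2Λ₀(f))` for ℤ-newforms»)

The same two rows quantified over rational newforms `f ∈ S₂(Γ₀(N))` directly (`IsNewform0 f`, `coeffField f = ⊥`), with the
kernel-checked edges newform-form ⟹ carrier-form (instantiate at `D₀.f`) and cyclic ⟹ not-inside-twice (core lemma of §4). -/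

/-- **E-desc-g26-1♮ (`f`-only form of row 1)**: for every rational newform `f ∈ S₂(Γ₀(N))`, `Λ₁(f) ⊄ 2Λ₀(f)`. CANDIDATE LAW — paper
theorem of MEMO-desc §51.6; nothing asserted. [cite: LingOesterle1991, Thm. 2] [cite: Stevens1989, §2] -/
@[conjecture] def NewformGamma1PeriodsNotInsideTwice : Prop :=
  ∀ {N : ℕ} [NeZero N] (f : CuspForm (Gamma0 N) 2), IsNewform0 f → coeffField f = ⊥ →
    ¬ (∀ z ∈ periodLatticeGamma1 f, ∃ w ∈ periodLattice f, z = 2 * w)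

/-- **E-desc-g26-2♮ (`f`-only form of row 2)**: for every rational newform `f ∈ S₂(Γ₀(N))`, `Λ₀(f)/Λ₁(f)` is cyclic:
`Λ₀(f) = ℤz₀ + Λ₁(f)` for some period `z₀`. CANDIDATE LAW — paper theorem of MEMO-desc §51.6 (COROLLARY CYC); nothing asserted.
[cite: LingOesterle1991, Thm. 2] [cite: Stevens1989, §2] -/
@[conjecture] def NewformShimuraKernelCyclic : Prop :=
  ∀ {N : ℕ} [NeZero N] (f : CuspForm (Gamma0 N) 2), IsNewform0 f → coeffField f = ⊥ →
    ∃ z₀ ∈ periodLattice f, ∀ z ∈ periodLattice f, ∃ (k : ℤ) (w : ℂ), w ∈ periodLatticeGamma1 f ∧ z = (k : ℂ) * z₀ + w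

/-- `f`-only row 2 ⟹ `f`-only row 1 (core parity lemma). -/
theorem newformNotInsideTwice_of_newformCyclic (h : NewformShimuraKernelCyclic) : NewformGamma1PeriodsNotInsideTwice := by
  intro N _ f hf hQ hin
  obtain ⟨z₀, hz₀, hcyc⟩ := h f hf hQ
  exact not_cyclic_and_insideTwice f hf hQ hz₀ hcyc hin

/-- `f`-only row 1 ⟹ carrier row 1 (instantiate at `D₀.f`, a rational newform by `D₀.isNewformOf`). -/
theorem notInsideTwice_of_newform (h : NewformGamma1PeriodsNotInsideTwice) : Gamma1PeriodsNotInsideTwiceGamma0Periods := by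
  intro W₀ _ N _ D₀
  exact h D₀.f D₀.isNewformOf.1 (IsNewformOf.coeffField_eq_bot D₀.isNewformOf)

/-- `f`-only row 2 ⟹ carrier row 2. -/
theorem shimuraKernelCyclic_of_newform (h : NewformShimuraKernelCyclic) : ShimuraKernelCyclic := by
  intro W₀ _ N _ D₀
  exact h D₀.f D₀.isNewformOf.1 (IsNewformOf.coeffField_eq_bot D₀.isNewformOf)

/-- `f`-only row 1 ⟹ the literal A-ref1-215-1 shape `¬(Λ₁(f) = 2Λ₀(f))` for every rational newform. -/
theorem newform_periodLatticeGamma1_ne_two_mul (h : NewformGamma1PeriodsNotInsideTwice) {N : ℕ} [NeZero N]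
    (f : CuspForm (Gamma0 N) 2) (hf : IsNewform0 f) (hQ : coeffField f = ⊥) :
    ¬ (∀ z : ℂ, z ∈ periodLatticeGamma1 f ↔ ∃ w ∈ periodLattice f, z = 2 * w) :=
  fun hiff => h f hf hQ (fun z hz => (hiff z).mp hz)

end Summit.BirchSwinnertonDyer.Rank1Residual.ManinAdditive.ShimuraCyclic

end
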